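import Literature.Geometry.Symplectic.OrigamiCutFormProduct
import Literature.Geometry.Symplectic.CircleQuotientForms
import Literature.Geometry.Manifold.CircleProdComplexTangent
import HarnessLib

/-!
# The cut form on `Z × ℂ` is basic for the diagonal circle action

Proofs companion of `OrigamiUnfolding.lean` (the named fact
`Literature.Geometry.Symplectic.exists_symplecticCutPieces_of_isOrigamiForm`, Cannas da
Silva–Guillemin–Pires, *Symplectic Origami*, IMRN 2011 = arXiv:0909.4065, Prop. 2.8; architecture
in `OrigamiUnfoldingProofs.lean`), step (S2) continued.  The form
`Ω = p^*ωZ + d(|w|² p^*α) - 2 dx∧dy` of `OrigamiCutFormProduct.lean`, transported to the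
recharted product `ProdC k N` (`CircleProdComplex.lean`; `cutForm ωZ α`), is BASIC for the
diagonal circle action `a • mk n w = mk (a • n) (a w)` as soon as `ωZ` is basic and `α` is a
connection form (invariant, `α(X) = 1`, with basic curvature `dα`): then it descends to the
associated bundle `ProdC k N / S¹ = N ×_{S¹} ℂ` — the local model of the cut piece near its centre
(proof of Prop. 2.8: the reduced form on `μ⁻¹(0)/S¹`).

* `cutForm ωZ α` and its values on the tangent frame (`cutForm_apply_tangentLift`,
  `cutForm_apply_pair`); `isSmoothForm_cutForm`, `isClosedForm_cutForm`;
* `inner_circle_mul`, `area_circle_mul`, `area_I_mul` — the three planar identities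
  `⟪aw, aσ⟫ = ⟪w, σ⟫`, `area(aσ, aτ) = area(σ, τ)`, `area(iw, τ) = -⟪w, τ⟫`;
* **`isCircleBasicForm_cutForm`** — invariance (term by term) and horizontality: on the
  generator `(X, iw)` of the diagonal action the value is
  `-2⟪w, τ⟫ α(X) - 2 area(iw, τ) = -2⟪w,τ⟫ + 2⟪w,τ⟫ = 0` (the moment-map cancellation of the
  cut);
* `cutForm_pullback_realSlice` — **along `(n, t) ↦ mk n t` the cut form pulls back to the model
  form `p^*ωZ + d(t² p^*α)`** of `OrigamiModelForm.lean` (the identity `β^*ω₁ = φ^*ω` of the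
  proof of Prop. 2.26 in the tree's coordinates).

Everything here is proved; the only definitions are `cutForm` and the real slice `realSlice`;
no facts.

## References

* A. Cannas da Silva, V. Guillemin, A. R. Pires, *Symplectic Origami*, IMRN 2011 =
  arXiv:0909.4065, §2.3, proofs of Prop. 2.8 and Prop. 2.26. [CannasdasilvaGuilleminPires2010]
-/

noncomputable section

open scoped Manifold ContDiff Topology RealInnerProductSpace
open Set Function Filter
open Literature.Geometry.Kaehler Literature.Geometry.Manifold

namespace Literature.Geometry.Symplectic

variable {k : ℕ} {N : Type*} [TopologicalSpace N] [ChartedSpace (EuclideanSpace ℝ (Fin k)) N]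
  [IsManifold (𝓡 k) ∞ N]

/-! ### The cut form on `ProdC k N` -/

/-- **The cut form** on the recharted product `ProdC k N`: the pull-back of
`prodCutForm ωZ α = p^*ωZ + d(|w|² p^*α) - 2 dx∧dy` along the identity `out : ProdC k N → N × ℂ`.
[cite: CannasdasilvaGuilleminPires2010, Prop. 2.8] -/
def cutForm (ωZ : MForm (𝓡 k) N ℝ 2) (α : MForm (𝓡 k) N ℝ 1) : MForm (𝓡 (k + 2)) (ProdC k N) ℝ 2 :=
  (prodCutForm ωZ α).pullback (𝓡 (k + 2)) (Rechart.out (prodCModel k) (N × ℂ))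

/-- The cut form on the tangent frame is `prodCutForm` on the components. [folklore] -/
theorem cutForm_apply_tangentLift (ωZ : MForm (𝓡 k) N ℝ 2) (α : MForm (𝓡 k) N ℝ 1)
    (p : ProdC k N) (a b : EuclideanSpace ℝ (Fin k)) (σ τ : ℂ) :
    cutForm ωZ α p ![ProdC.tangentLift k a σ, ProdC.tangentLift k b τ] =
      prodCutForm ωZ α (ProdC.fst p, ProdC.snd p)
        ![((a, σ) : EuclideanSpace ℝ (Fin k) × ℂ), ((b, τ) : EuclideanSpace ℝ (Fin k) × ℂ)] := by
  rw [cutForm, MForm.pullback_apply, (ProdC.hasMFDerivAt_out p).mfderiv]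
  have hvec : (fun i : Fin 2 => ((prodCModelIso k).symm :
      EuclideanSpace ℝ (Fin (k + 2)) →L[ℝ] EuclideanSpace ℝ (Fin k) × ℂ)
      (![ProdC.tangentLift k a σ, ProdC.tangentLift k b τ] i)) =
      ![((a, σ) : EuclideanSpace ℝ (Fin k) × ℂ), ((b, τ) : EuclideanSpace ℝ (Fin k) × ℂ)] := by
    funext i
    fin_cases i
    · show (prodCModelIso k).symm (ProdC.tangentLift k a σ) = (a, σ)
      rw [ProdC.tangentLift_eq, ContinuousLinearEquiv.symm_apply_apply]
    · show (prodCModelIso k).symm (ProdC.tangentLift k b τ) = (b, τ)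
      rw [ProdC.tangentLift_eq, ContinuousLinearEquiv.symm_apply_apply]
  exact congrArg (prodCutForm ωZ α (Rechart.out (prodCModel k) (N × ℂ) p)) hvec

/-- **Values of the cut form on the tangent frame.** [cite: CannasdasilvaGuilleminPires2010, Prop. 2.8] -/
theorem cutForm_apply_tangentLift_eq (ωZ : MForm (𝓡 k) N ℝ 2) {α : MForm (𝓡 k) N ℝ 1}
    (hα : IsSmoothForm α) (p : ProdC k N) (a b : EuclideanSpace ℝ (Fin k)) (σ τ : ℂ) :
    cutForm ωZ α p ![ProdC.tangentLift k a σ, ProdC.tangentLift k b τ] =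
      ωZ (ProdC.fst p) ![a, b] + ‖ProdC.snd p‖ ^ 2 * mextDeriv α (ProdC.fst p) ![a, b] +
        (2 * ⟪ProdC.snd p, σ⟫ * α (ProdC.fst p) ![b] - 2 * ⟪ProdC.snd p, τ⟫ * α (ProdC.fst p) ![a]) -
        2 * (σ.re * τ.im - σ.im * τ.re) := by
  rw [cutForm_apply_tangentLift, prodCutForm_apply ωZ hα]

/-- Values of the cut form on an arbitrary pair of tangent vectors, through their components.
[folklore] -/
theorem cutForm_apply_pair (ωZ : MForm (𝓡 k) N ℝ 2) {α : MForm (𝓡 k) N ℝ 1}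
    (hα : IsSmoothForm α) (p : ProdC k N) (u u' : TangentSpace (𝓡 (k + 2)) p) :
    cutForm ωZ α p ![u, u'] =
      ωZ (ProdC.fst p) ![mfderiv (𝓡 (k + 2)) (𝓡 k) ProdC.fst p u,
          mfderiv (𝓡 (k + 2)) (𝓡 k) ProdC.fst p u'] +
        ‖ProdC.snd p‖ ^ 2 * mextDeriv α (ProdC.fst p)
          ![mfderiv (𝓡 (k + 2)) (𝓡 k) ProdC.fst p u, mfderiv (𝓡 (k + 2)) (𝓡 k) ProdC.fst p u'] +
        (2 * ⟪ProdC.snd p, mfderiv (𝓡 (k + 2)) 𝓘(ℝ, ℂ) ProdC.snd p u⟫ *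
            α (ProdC.fst p) ![mfderiv (𝓡 (k + 2)) (𝓡 k) ProdC.fst p u'] -
          2 * ⟪ProdC.snd p, mfderiv (𝓡 (k + 2)) 𝓘(ℝ, ℂ) ProdC.snd p u'⟫ *
            α (ProdC.fst p) ![mfderiv (𝓡 (k + 2)) (𝓡 k) ProdC.fst p u]) -
        2 * ((mfderiv (𝓡 (k + 2)) 𝓘(ℝ, ℂ) ProdC.snd p u).re *
            (mfderiv (𝓡 (k + 2)) 𝓘(ℝ, ℂ) ProdC.snd p u').im -
          (mfderiv (𝓡 (k + 2)) 𝓘(ℝ, ℂ) ProdC.snd p u).im *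
            (mfderiv (𝓡 (k + 2)) 𝓘(ℝ, ℂ) ProdC.snd p u').re) := by
  conv_lhs => rw [ProdC.eq_tangentLift p u, ProdC.eq_tangentLift p u']
  exact cutForm_apply_tangentLift_eq ωZ hα p _ _ _ _

/-- **The cut form is smooth** (for smooth `ωZ`, `α`). [folklore] -/
theorem isSmoothForm_cutForm {ωZ : MForm (𝓡 k) N ℝ 2} (hωZ : IsSmoothForm ωZ)
    {α : MForm (𝓡 k) N ℝ 1} (hα : IsSmoothForm α) : IsSmoothForm (cutForm ωZ α) :=
  (isSmoothForm_iff_smoothAt _).2 fun _ =>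
    MForm.SmoothAt.pullback (Eventually.of_forall fun _ => ProdC.contMDiff_out.contMDiffAt)
      ((isSmoothForm_iff_smoothAt _).1 (isSmoothForm_prodCutForm hωZ hα) _)

/-- **The cut form is closed** when `ωZ` is. [cite: CannasdasilvaGuilleminPires2010, Prop. 2.8] -/
theorem isClosedForm_cutForm {ωZ : MForm (𝓡 k) N ℝ 2} (hωZ : IsSmoothForm ωZ)
    (hωZc : IsClosedForm ωZ) {α : MForm (𝓡 k) N ℝ 1} (hα : IsSmoothForm α) :
    IsClosedForm (cutForm ωZ α) := by
  show mextDeriv (cutForm ωZ α) = 0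
  funext p
  rw [cutForm, mextDeriv_pullback_apply
    (Eventually.of_forall fun _ => ProdC.contMDiff_out.contMDiffAt)
    ((isSmoothForm_iff_smoothAt _).1 (isSmoothForm_prodCutForm hωZ hα) _)]
  have h0 : mextDeriv (prodCutForm ωZ α) = 0 := isClosedForm_prodCutForm hωZ hωZc hα
  rw [h0, MForm.pullback_zero]

/-! ### Three planar identities -/

omit [IsManifold (𝓡 k) ∞ N] in
/-- Rotations are isometries: `⟪aw, aσ⟫ = ⟪w, σ⟫` for `a ∈ S¹`. [folklore] -/
theorem inner_circle_mul (a : Circle) (w σ : ℂ) : ⟪(a : ℂ) * w, (a : ℂ) * σ⟫ = ⟪w, σ⟫ := by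
  rw [Complex.inner, Complex.inner, map_mul]
  have h1 : (a : ℂ) * σ * ((starRingEnd ℂ) (a : ℂ) * (starRingEnd ℂ) w) =
      ((a : ℂ) * (starRingEnd ℂ) (a : ℂ)) * (σ * (starRingEnd ℂ) w) := by ring
  rw [h1, Complex.mul_conj, Circle.normSq_coe, Complex.ofReal_one, one_mul]

omit [IsManifold (𝓡 k) ∞ N] in
/-- Rotations preserve area: `area(aσ, aτ) = area(σ, τ)` for `a ∈ S¹`. [folklore] -/
theorem area_circle_mul (a : Circle) (σ τ : ℂ) :
    ((a : ℂ) * σ).re * ((a : ℂ) * τ).im - ((a : ℂ) * σ).im * ((a : ℂ) * τ).re =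
      σ.re * τ.im - σ.im * τ.re := by
  have ha : (a : ℂ).re ^ 2 + (a : ℂ).im ^ 2 = 1 := by
    have h := Circle.normSq_coe a
    rw [Complex.normSq_apply] at h
    nlinarith [h]
  simp only [Complex.mul_re, Complex.mul_im]
  linear_combination (σ.re * τ.im - σ.im * τ.re) * ha

omit [IsManifold (𝓡 k) ∞ N] in
/-- `area(iw, τ) = -⟪w, τ⟫`. [folklore] -/
theorem area_I_mul (w τ : ℂ) :
    (Complex.I * w).re * τ.im - (Complex.I * w).im * τ.re = -⟪w, τ⟫ := by
  rw [Complex.inner]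
  simp only [Complex.mul_re, Complex.mul_im, Complex.I_re, Complex.I_im, zero_mul, one_mul,
    zero_sub, zero_add, Complex.conj_re, Complex.conj_im]
  ring

omit [IsManifold (𝓡 k) ∞ N] in
/-- `⟪w, iw⟫ = 0`. [folklore] -/
theorem inner_self_I_mul (w : ℂ) : ⟪w, Complex.I * w⟫ = 0 := by
  rw [Complex.inner]
  simp only [Complex.mul_re, Complex.mul_im, Complex.I_re, Complex.I_im, zero_mul, one_mul,
    zero_sub, zero_add, Complex.conj_re, Complex.conj_im]
  ring

/-! ### The cut form is basic -/

variable [MulAction Circle N]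

/-- **The cut form is basic for the diagonal circle action** when `ωZ` is basic and `α` is a
connection form with basic curvature (Cannas da Silva–Guillemin–Pires, proof of Prop. 2.8: the
reduced form of the cut). Horizontality is the cancellation
`ι_{(X, iw)} Ω = -2⟪w, ·⟫ α(X) - 2 area(iw, ·) = 0`. [cite: CannasdasilvaGuilleminPires2010, Prop. 2.8] -/
theorem isCircleBasicForm_cutForm
    (hθ : ContMDiff ((𝓡 1).prod (𝓡 k)) (𝓡 k) ∞ (fun x : Circle × N => x.1 • x.2))
    {ωZ : MForm (𝓡 k) N ℝ 2} (hωZ : IsCircleBasicForm ωZ)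
    {α : MForm (𝓡 k) N ℝ 1} (hα : IsSmoothForm α)
    (hαi : ∀ (a : Circle) (n : N) (v : Fin 1 → TangentSpace (𝓡 k) n),
      α (a • n) (fun i => mfderiv (𝓡 k) (𝓡 k) (fun y : N => a • y) n (v i)) = α n v)
    (hαX : ∀ n : N, α n ![circleFundVec n] = 1)
    (hdα : IsCircleBasicForm (mextDeriv α)) :
    IsCircleBasicForm (cutForm ωZ α) := by
  -- abbreviations for the component maps
  have hv2 : ∀ (q : ProdC k N) (v : Fin 2 → TangentSpace (𝓡 (k + 2)) q), v = ![v 0, v 1] :=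
    fun q v => by funext j; fin_cases j <;> rfl
  have hαi1 : ∀ (a : Circle) (n : N) (b : TangentSpace (𝓡 k) n),
      α (a • n) ![mfderiv (𝓡 k) (𝓡 k) (fun y : N => a • y) n b] = α n ![b] := by
    intro a n b
    have h := hαi a n ![b]
    have hfun : (fun i : Fin 1 => mfderiv (𝓡 k) (𝓡 k) (fun y : N => a • y) n (![b] i)) =
        ![mfderiv (𝓡 k) (𝓡 k) (fun y : N => a • y) n b] := by
      funext i; fin_cases i; rfl
    rw [hfun] at h
    exact h
  have hinv2 : ∀ {β : MForm (𝓡 k) N ℝ 2}, IsCircleBasicForm β →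
      ∀ (a : Circle) (n : N) (b b' : TangentSpace (𝓡 k) n),
      β (a • n) ![mfderiv (𝓡 k) (𝓡 k) (fun y : N => a • y) n b,
        mfderiv (𝓡 k) (𝓡 k) (fun y : N => a • y) n b'] = β n ![b, b'] := by
    intro β hβ a n b b'
    have h := hβ.invariant a n ![b, b']
    have hfun : (fun i : Fin 2 => mfderiv (𝓡 k) (𝓡 k) (fun y : N => a • y) n (![b, b'] i)) =
        ![mfderiv (𝓡 k) (𝓡 k) (fun y : N => a • y) n b,
          mfderiv (𝓡 k) (𝓡 k) (fun y : N => a • y) n b'] := by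
      funext i; fin_cases i <;> rfl
    rw [hfun] at h
    exact h
  refine ⟨fun a p v => ?_, fun p v i hi => ?_⟩
  · -- invariance
    have hL : (fun i => mfderiv (𝓡 (k + 2)) (𝓡 (k + 2)) (fun q : ProdC k N => a • q) p (v i)) =
        ![mfderiv (𝓡 (k + 2)) (𝓡 (k + 2)) (fun q : ProdC k N => a • q) p (v 0),
          mfderiv (𝓡 (k + 2)) (𝓡 (k + 2)) (fun q : ProdC k N => a • q) p (v 1)] := by
      funext i; fin_cases i <;> rfl
    rw [hL]
    conv_rhs => rw [hv2 _ v]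
    conv_lhs => rw [ProdC.eq_tangentLift p (v 0), ProdC.eq_tangentLift p (v 1),
      ProdC.mfderiv_const_smul_prodC_tangentLift hθ, ProdC.mfderiv_const_smul_prodC_tangentLift hθ]
    conv_rhs => rw [ProdC.eq_tangentLift p (v 0), ProdC.eq_tangentLift p (v 1)]
    rw [cutForm_apply_tangentLift_eq ωZ hα, cutForm_apply_tangentLift_eq ωZ hα,
      ProdC.fst_smul, ProdC.snd_smul, hinv2 hωZ, hinv2 hdα, hαi1, hαi1, inner_circle_mul,
      inner_circle_mul, area_circle_mul, norm_mul, Circle.norm_coe, one_mul]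
  · -- horizontality
    set n := ProdC.fst p with hn
    set w := ProdC.snd p with hw
    have hY : circleFundVec p = ProdC.tangentLift k (circleFundVec n) (Complex.I * w) := by
      rw [circleFundVec_eq, circleFundVec_eq, ← ProdC.mk_fst_snd p]
      exact ProdC.mfderiv_circleOrbit_prodC hθ _ _
    -- the value on `(Y, u)` vanishes
    have key : ∀ (b : EuclideanSpace ℝ (Fin k)) (τ : ℂ),
        cutForm ωZ α p ![ProdC.tangentLift k (circleFundVec n) (Complex.I * w),
          ProdC.tangentLift k b τ] = 0 := by
      intro b τ
      rw [cutForm_apply_tangentLift_eq ωZ hα, ← hn, ← hw,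
        hωZ.horizontal n ![circleFundVec n, b] 0 rfl, hdα.horizontal n ![circleFundVec n, b] 0 rfl,
        hαX n, inner_self_I_mul, area_I_mul]
      ring
    rw [hv2 _ v]
    fin_cases i
    · -- `v 0 = Y`
      have h0 : v 0 = ProdC.tangentLift k (circleFundVec n) (Complex.I * w) := hi.trans hY
      rw [h0, ProdC.eq_tangentLift p (v 1)]
      exact key _ _
    · -- `v 1 = Y`: antisymmetry
      have h1 : v 1 = ProdC.tangentLift k (circleFundVec n) (Complex.I * w) := hi.trans hY
      have hswap : cutForm ωZ α p ![v 0, v 1] = -cutForm ωZ α p ![v 1, v 0] := by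
        have h := (cutForm ωZ α p).map_swap (v := ![v 1, v 0]) (i := 0) (j := 1) (by decide)
        have hsw : ![v 1, v 0] ∘ (Equiv.swap (0 : Fin 2) 1) = ![v 0, v 1] := by
          funext i; fin_cases i <;> rfl
        rw [hsw] at h
        exact h
      rw [hswap, h1, ProdC.eq_tangentLift p (v 0), key, neg_zero]

/-! ### The real slice -/

omit [IsManifold (𝓡 k) ∞ N] [MulAction Circle N] in
/-- `(n, t) ↦ (t : ℂ)` is `C^∞` on `N × ℝ` with differential `(a, σ) ↦ σ`. [folklore] -/
theorem hasMFDerivAt_ofReal_snd (x : N × ℝ) :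
    HasMFDerivAt ((𝓡 k).prod 𝓘(ℝ, ℝ)) 𝓘(ℝ, ℂ) (fun q : N × ℝ => (q.2 : ℂ)) x
      (Complex.ofRealCLM.comp (ContinuousLinearMap.snd ℝ (EuclideanSpace ℝ (Fin k)) ℝ)) := by
  have h1 : HasMFDerivAt 𝓘(ℝ, ℝ) 𝓘(ℝ, ℂ) (fun t : ℝ => (t : ℂ)) x.2 Complex.ofRealCLM :=
    hasMFDerivAt_iff_hasFDerivAt.2 Complex.ofRealCLM.hasFDerivAt
  exact h1.comp x (hasMFDerivAt_snd (I := 𝓡 k) (I' := 𝓘(ℝ, ℝ)) x)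

/-- **The real slice** `(n, t) ↦ mk n t` of `ProdC k N`. [folklore] -/
def realSlice (k : ℕ) (N : Type*) [TopologicalSpace N] [ChartedSpace (EuclideanSpace ℝ (Fin k)) N]
    (q : N × ℝ) : ProdC k N :=
  ProdC.mk q.1 (q.2 : ℂ)

omit [MulAction Circle N] in
/-- The real slice is `C^∞`. [folklore] -/
theorem contMDiff_realSlice : ContMDiff ((𝓡 k).prod 𝓘(ℝ, ℝ)) (𝓡 (k + 2)) ∞ (realSlice k N) :=
  ContMDiff.prodC_mk contMDiff_fst
    ((Complex.ofRealCLM.contDiff.comp_contMDiff contMDiff_snd))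

omit [MulAction Circle N] in
/-- The differential of the real slice: `d(realSlice)(a, σ) = L (a, σ)`. [folklore] -/
theorem mfderiv_realSlice_apply (x : N × ℝ) (a : EuclideanSpace ℝ (Fin k)) (σ : ℝ) :
    mfderiv ((𝓡 k).prod 𝓘(ℝ, ℝ)) (𝓡 (k + 2)) (realSlice k N) x
      (((a, σ) : EuclideanSpace ℝ (Fin k) × ℝ)) = ProdC.tangentLift k a (σ : ℂ) := by
  have H := ProdC.hasMFDerivAt_prodC_mk (N := N)
    (hasMFDerivAt_fst (I := 𝓡 k) (I' := 𝓘(ℝ, ℝ)) x) (hasMFDerivAt_ofReal_snd x)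
  change mfderiv ((𝓡 k).prod 𝓘(ℝ, ℝ)) (𝓡 (k + 2))
    (fun q : N × ℝ => (ProdC.mk q.1 (q.2 : ℂ) : ProdC k N)) x ((a, σ) : EuclideanSpace ℝ (Fin k) × ℝ) = _
  rw [H.mfderiv]
  rfl

omit [MulAction Circle N] in
/-- **Along the real slice the cut form pulls back to the model form** `p^*ωZ + d(t² p^*α)` of
`OrigamiModelForm.lean`. [cite: CannasdasilvaGuilleminPires2010, Prop. 2.26] -/
theorem cutForm_pullback_realSlice (ωZ : MForm (𝓡 k) N ℝ 2) {α : MForm (𝓡 k) N ℝ 1}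
    (hα : IsSmoothForm α) :
    (cutForm ωZ α).pullback ((𝓡 k).prod 𝓘(ℝ, ℝ)) (realSlice k N) =
      ωZ.pullback ((𝓡 k).prod 𝓘(ℝ, ℝ)) (Prod.fst : N × ℝ → N) +
        mextDeriv ((fun q : N × ℝ => q.2 ^ 2) •
          α.pullback ((𝓡 k).prod 𝓘(ℝ, ℝ)) (Prod.fst : N × ℝ → N)) := by
  funext x
  obtain ⟨n, t⟩ := x
  -- two alternating maps on `ℝᵏ × ℝ` agreeing on all pairs
  have hpair : ∀ (v : Fin 2 → EuclideanSpace ℝ (Fin k) × ℝ),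
      v = ![((v 0).1, (v 0).2), ((v 1).1, (v 1).2)] := by
    intro v; funext j; fin_cases j <;> simp
  ext v
  rw [hpair v, MForm.pullback_apply]
  have hvec : (fun i : Fin 2 => mfderiv ((𝓡 k).prod 𝓘(ℝ, ℝ)) (𝓡 (k + 2)) (realSlice k N) (n, t)
      (![(((v 0).1, (v 0).2) : EuclideanSpace ℝ (Fin k) × ℝ),
        (((v 1).1, (v 1).2) : EuclideanSpace ℝ (Fin k) × ℝ)] i)) =
      ![ProdC.tangentLift k (v 0).1 ((v 0).2 : ℂ), ProdC.tangentLift k (v 1).1 ((v 1).2 : ℂ)] := by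
    funext i
    fin_cases i
    · exact mfderiv_realSlice_apply (n, t) _ _
    · exact mfderiv_realSlice_apply (n, t) _ _
  rw [show (fun i : Fin 2 => mfderiv ((𝓡 k).prod 𝓘(ℝ, ℝ)) (𝓡 (k + 2)) (realSlice k N) (n, t)
      (![(((v 0).1, (v 0).2) : EuclideanSpace ℝ (Fin k) × ℝ),
        (((v 1).1, (v 1).2) : EuclideanSpace ℝ (Fin k) × ℝ)] i)) = _ from hvec]
  exact (cutForm_apply_tangentLift ωZ α _ _ _ _ _).trans
    (prodCutForm_apply_ofReal_eq_modelForm ωZ hα n t _ _ _ _)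

end Literature.Geometry.Symplectic

end
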